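import Mathlib
import Summits.Ventures.PercRepro2.SwOutShadowMultiRootCube
import Summits.Ventures.PercRepro2.SwOutMultiRootEIneq

/-!
# THE DECORATED MULTI-ROOT CUBE INEQUALITY (blind cell PercRepro2, night-4 g35, 2026-08-29;
proofs/NIGHT4-G35.md §3)

The red edge set of `h` is increasing in the cube point and the blue one decreasing, the flip of
the cube (every unit and every root–root edge) exchanges the red and the blue clusters and edge sets
of a root, the cube stays in the class (the units inside `U`), the general doubly typed side pulls
back to a lower set — the conditions at `l` by the two decorated monotonicities of
SwOutShadowMultiRootCube —, the realisation is injective, and the rigid counting inequality holds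
on `gTypedQ` over the decorated cube `decoCubeRR`: **`DecoBaseE.card_decoCubeRR_le_g`** (g10's
`card_le_of_cube_edges` on the cube `Config (ι ⊕ ↥RR)`).  This is the abstract half of the
multi-root SHADOW: the blocks of a class whose junctions escape in blue (NIGHT4-G34.md §8 (a)).
-/

namespace Summit.Ventures.PercRepro2

namespace LocRows

open Hull

variable {V : Type*} {E : Type*}

open scoped Classical

variable {ends : E → Sym2 V}

section CubeDef

variable [Fintype E] [DecidableEq E] {ι : Type*} [Fintype ι]

variable (ends) in
/-- The decorated cube with root–root coordinates: the realisations of all cube points. -/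
noncomputable def decoCubeRR (A Z : ι → Set V) (RR : Finset E) (ζ : Config E) :
    Finset (Config E) :=
  Finset.univ.image (decoRealRR ends A Z RR ζ)

/-- Membership in the decorated cube. -/
lemma mem_decoCubeRR {A Z : ι → Set V} {RR : Finset E} {ζ ζ' : Config E} :
    ζ' ∈ decoCubeRR ends A Z RR ζ ↔ ∃ ω, decoRealRR ends A Z RR ζ ω = ζ' := by
  simp only [decoCubeRR, Finset.mem_image, Finset.mem_univ, true_and]

end CubeDef

section Ineq

variable {ι : Type*} {A Z : ι → Set V} {ζ : Config E} {R H : Set V} {l : V} {RR : Finset E}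
  {h : V} (hb : DecoBaseE ends ζ R H l A Z RR)
include hb

/-- **The red edge set of `h` is increasing in the cube point.** -/
theorem DecoBaseE.redEdges_decoRealRR_mono (hh : h ∈ R) {ω ω' : Config (ι ⊕ ↥RR)} (hω : ω ≤ ω') :
    redEdges ends (decoRealRR ends A Z RR ζ ω) h ⊆
      redEdges ends (decoRealRR ends A Z RR ζ ω') h := by
  rintro e ⟨he, hw⟩
  exact ⟨hb.decoRealRR_le_of_within_true hω (hb.within_cluster_subset hh ω hw) he,
    within_mono (hb.cluster_decoRealRR_mono hh hω) hw⟩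

/-- **The blue edge set of `h` is decreasing in the cube point.** -/
theorem DecoBaseE.blueEdges_decoRealRR_anti (hh : h ∈ R) {ω ω' : Config (ι ⊕ ↥RR)} (hω : ω ≤ ω') :
    blueEdges ends (decoRealRR ends A Z RR ζ ω') h ⊆
      blueEdges ends (decoRealRR ends A Z RR ζ ω) h := by
  rintro e ⟨he, hw⟩
  refine ⟨?_, within_mono (hb.cluster_blue_decoRealRR_anti hh hω) hw⟩
  rw [blue_eq_true_iff] at he ⊢
  exact hb.decoRealRR_blue_of_within_false hω (hb.within_cluster_blue_subset hh ω' hw) he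

/-! ### The flip of the cube -/

/-- The flipped cube point negates every edge touching a unit or joining two roots. -/
lemma DecoBaseE.decoRealRR_flipAll_apply {ω : Config (ι ⊕ ↥RR)} {e : E}
    (he : e ∈ touches ends (allArms (unitAZ A Z)) ∨ e ∈ RR) :
    decoRealRR ends A Z RR ζ (flipAll ω) e = !decoRealRR ends A Z RR ζ ω e := by
  by_cases hrr : e ∈ RR
  · rw [decoRealRR_apply_rr hrr, decoRealRR_apply_rr hrr]
    by_cases hi : ω (Sum.inr ⟨e, hrr⟩) = true
    · have : flipAll ω (Sum.inr ⟨e, hrr⟩) ≠ true := by simp [flipAll, hi]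
      rw [if_neg this, if_pos hi]
    · have : flipAll ω (Sum.inr ⟨e, hrr⟩) = true := by simp [flipAll]; simpa using hi
      rw [if_pos this, if_neg hi, Bool.not_not]
  · have ht : e ∈ touches ends (allArms (unitAZ A Z)) := by
      rcases he with he | he
      · exact he
      · exact absurd he hrr
    obtain ⟨i, x, y, hxy, hx⟩ := DecoBaseE.exists_unit_of_touches ht
    rw [hb.decoRealRR_apply_of_mem hxy hx, hb.decoRealRR_apply_of_mem hxy hx]
    by_cases hi : ω (Sum.inl i) = true
    · have : flipAll ω (Sum.inl i) ≠ true := by simp [flipAll, hi]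
      rw [if_neg this, if_pos hi]
    · have : flipAll ω (Sum.inl i) = true := by simp [flipAll]; simpa using hi
      rw [if_pos this, if_neg hi, Bool.not_not]

/-- An edge inside `H` touches a unit or joins two roots. -/
lemma DecoBaseE.touches_or_rr_of_within {e : E} (he : e ∈ within ends H) :
    e ∈ touches ends (allArms (unitAZ A Z)) ∨ e ∈ RR := by
  obtain ⟨x, hx, y, hy, hxy⟩ := he
  by_cases hxR : x ∈ R
  · by_cases hyR : y ∈ R
    · exact Or.inr (hb.base.mem_rr hxR hyR hxy)
    · obtain ⟨i, hi⟩ := hb.base.arm_cover y hy hyR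
      exact Or.inl ⟨y, ⟨i, Or.inl hi⟩, x, ends_swap hxy⟩
  · obtain ⟨i, hi⟩ := hb.base.arm_cover x hx hxR
    exact Or.inl ⟨x, ⟨i, Or.inl hi⟩, y, hxy⟩

/-- **The flip of the cube exchanges the red and the blue clusters of a root.** -/
theorem DecoBaseE.cluster_blue_decoRealRR_flipAll {r : V} (hr : r ∈ R) (ω : Config (ι ⊕ ↥RR)) :
    cluster ends (blue (decoRealRR ends A Z RR ζ (flipAll ω))) r =
      cluster ends (decoRealRR ends A Z RR ζ ω) r := by
  have hsub : within ends (R ∪ armsTrueC A (armPart ω)) ⊆ within ends H := by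
    rintro e ⟨x, hx, y, hy, hxy⟩
    have key : ∀ z, z ∈ R ∪ armsTrueC A (armPart ω) → z ∈ H := by
      rintro z (hz | ⟨i, _, hz⟩)
      · exact hb.base.root_sub hz
      · exact (hb.base.arm_sub i z hz).1
    exact ⟨x, key x hx, y, key y hy, hxy⟩
  have hag : ∀ e ∈ within ends (R ∪ armsTrueC A (armPart ω)),
      blue (decoRealRR ends A Z RR ζ (flipAll ω)) e = decoRealRR ends A Z RR ζ ω e := by
    intro e he
    rw [blue_apply, hb.decoRealRR_flipAll_apply (hb.touches_or_rr_of_within (hsub he)),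
      Bool.not_not]
  have hflip : armsFalseC A (armPart (flipAll ω)) = armsTrueC A (armPart ω) := by
    ext x; simp [armsFalseC, armsTrueC, armPart, flipAll]
  apply Set.Subset.antisymm
  · refine cluster_subset_of_le_within (S := R ∪ armsTrueC A (armPart ω)) ?_ (Or.inl hr)
      (fun e he h' => by rw [← hag e he]; exact h')
    intro x hx y hxy
    have := hb.blue_closed (flipAll ω) (x := x) (y := y) (by rwa [hflip]) hxy
    rwa [hflip] at this
  · exact cluster_subset_of_le_within (S := R ∪ armsTrueC A (armPart ω))
      (fun _ hx _ hxy => hb.red_closed ω hx hxy) (Or.inl hr)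
      (fun e he h' => by rw [hag e he]; exact h')

/-- **The flip of the cube exchanges the red and the blue edge sets of `h`.** -/
theorem DecoBaseE.blueEdges_decoRealRR_flipAll (hh : h ∈ R) (ω : Config (ι ⊕ ↥RR)) :
    blueEdges ends (decoRealRR ends A Z RR ζ (flipAll ω)) h =
      redEdges ends (decoRealRR ends A Z RR ζ ω) h := by
  ext e
  simp only [blueEdges, mem_redEdges, hb.cluster_blue_decoRealRR_flipAll hh ω]
  have hsub : within ends (cluster ends (decoRealRR ends A Z RR ζ ω) h) ⊆ within ends H :=
    within_mono (fun x hx => hb.hull_subset ω hh (Or.inl hx))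
  constructor
  · rintro ⟨he, hw⟩
    refine ⟨?_, hw⟩
    rw [blue_apply, hb.decoRealRR_flipAll_apply (hb.touches_or_rr_of_within (hsub hw)),
      Bool.not_not] at he
    exact he
  · rintro ⟨he, hw⟩
    refine ⟨?_, hw⟩
    rw [blue_apply, hb.decoRealRR_flipAll_apply (hb.touches_or_rr_of_within (hsub hw)),
      Bool.not_not]
    exact he

/-! ### The class, the side, the injectivity and the inequality -/

/-- **The cube stays in the class** (`H` and the decorations inside `U`, the base in the class). -/
theorem DecoBaseE.decoRealRR_mem_outClass [Fintype E] [DecidableEq E] {U : Set V} {ξ : Config E}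
    (hh : h ∈ R) (hHU : H ⊆ U) (hZU : ∀ i, Z i ⊆ U) (hcl : ζ ∈ outClass ends U h ξ)
    (ω : Config (ι ⊕ ↥RR)) : decoRealRR ends A Z RR ζ ω ∈ outClass ends U h ξ := by
  rw [mem_outClass] at hcl ⊢
  refine ⟨fun e he => ?_, (hb.hull_subset ω hh).trans hHU⟩
  rw [← hcl.1 e he]
  apply DecoBaseE.decoRealRR_apply_of_notMem
  · intro ht
    apply he
    obtain ⟨x, ⟨i, hx⟩, y, hxy⟩ := ht
    refine ⟨x, ?_, y, hxy⟩
    rcases hx with hx | hx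
    · exact hHU (hb.base.arm_sub i x hx).1
    · exact hZU i hx
  · intro hrr
    apply he
    obtain ⟨r, hr, r', -, hrr'⟩ := (hb.base.rr_iff e).1 hrr
    exact ⟨r, hHU (hb.base.root_sub hr), r', hrr'⟩

/-- **The general doubly typed side pulls back to a lower set of the decorated cube** (`X`
outside `H`). -/
theorem DecoBaseE.decoRealRR_mem_gTypedQ_of_le [Fintype E] [DecidableEq E]
    {𝓤 𝓓 𝓓'' : Set (Set V)} {X : Set V} {𝓤' : Set (Set V)} (hh : h ∈ R) (h𝓤 : IsUpperSet 𝓤)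
    (h𝓓 : IsLowerSet 𝓓) (h𝓓'' : IsLowerSet 𝓓'') (h𝓤' : IsUpperSet 𝓤')
    (hX : ∀ x ∈ X, x ∉ H) {ω ω' : Config (ι ⊕ ↥RR)} (hω : ω ≤ ω')
    (hQ : decoRealRR ends A Z RR ζ ω' ∈ gTypedQ ends l h 𝓤 𝓓 𝓓'' X 𝓤') :
    decoRealRR ends A Z RR ζ ω ∈ gTypedQ ends l h 𝓤 𝓓 𝓓'' X 𝓤' := by
  rw [mem_gTypedQ] at hQ ⊢
  obtain ⟨-, hA, hB, hRh, -, hBh⟩ := hQ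
  refine ⟨?_, h𝓤 (hb.cluster_l_decoRealRR_anti hω) hA,
    h𝓓 (hb.cluster_blue_l_decoRealRR_mono hω) hB,
    h𝓓'' (hb.cluster_decoRealRR_mono hh hω) hRh, ?_,
    h𝓤' (hb.cluster_blue_decoRealRR_anti hh hω) hBh⟩
  · rintro (hhl | hhl)
    · exact (hb.root_notMem_cluster_out ω hb.l_notMem hh).1 hhl
    · exact (hb.root_notMem_cluster_out ω hb.l_notMem hh).2 hhl
  · intro x hx hxH
    exact hX x hx (hb.hull_subset ω hh hxH)

/-- **The realisation is injective.** -/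
theorem DecoBaseE.decoRealRR_injective : Function.Injective (decoRealRR ends A Z RR ζ) := by
  intro ω ω' heq
  funext i
  rcases i with i | ⟨e, he⟩
  · obtain ⟨x, hx⟩ := hb.base.arm_nonempty i
    obtain ⟨r, hr, hxr⟩ := hb.base.conn i x hx
    have hxe : ∃ e, x ∈ ends e :=
      exists_edge_of_mem_cluster (h := r) hxr (fun h' => (hb.base.arm_sub i x hx).2 (h' ▸ hr))
    obtain ⟨e, hxe⟩ := hxe
    have hxy : ends e = s(x, Sym2.Mem.other hxe) := (Sym2.other_spec hxe).symm
    have h1 := hb.decoRealRR_apply_of_mem (ω := ω) hxy (Or.inl hx)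
    have h2 := hb.decoRealRR_apply_of_mem (ω := ω') hxy (Or.inl hx)
    rw [heq] at h1
    rw [h1] at h2
    by_contra hne
    have key : ∀ b b' : Bool, b ≠ b' →
        (if b = true then ζ e else !ζ e) ≠ (if b' = true then ζ e else !ζ e) := by
      intro b b' hbb'
      cases b <;> cases b' <;> simp at hbb' ⊢
    exact key _ _ hne h2
  · have h1 := hb.decoRealRR_rr_edge (ω := ω) he
    have h2 := hb.decoRealRR_rr_edge (ω := ω') he
    rw [heq] at h1
    by_contra hne
    cases hω : ω (Sum.inr ⟨e, he⟩) with
    | true =>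
      have := h2.1 (h1.2 hω)
      rw [hω] at hne; exact hne this.symm
    | false =>
      have h3 : ω' (Sum.inr ⟨e, he⟩) ≠ true := fun h' => by
        have := h1.1 (h2.2 h'); rw [hω] at this; simp at this
      have h3' : ω' (Sum.inr ⟨e, he⟩) = false := Bool.eq_false_iff.mpr h3
      rw [hω, h3'] at hne; exact hne rfl

/-- **THE DECORATED MULTI-ROOT CUBE INEQUALITY, GENERAL DOUBLY TYPED SIDE**: the rigid counting
inequality on `gTypedQ` over the decorated cube of a decorated base (`X` outside `H`). -/
theorem DecoBaseE.card_decoCubeRR_le_g [Fintype E] [DecidableEq E] [Fintype ι]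
    {𝓤 𝓓 𝓓'' : Set (Set V)} {X : Set V} {𝓤' : Set (Set V)} (hh : h ∈ R) (h𝓤 : IsUpperSet 𝓤)
    (h𝓓 : IsLowerSet 𝓓) (h𝓓'' : IsLowerSet 𝓓'') (h𝓤' : IsUpperSet 𝓤')
    (hX : ∀ x ∈ X, x ∉ H) {𝓔 : Set (Set E)} (h𝓔 : IsUpperSet 𝓔) :
    ((decoCubeRR ends A Z RR ζ).filter fun ζ' =>
        ζ' ∈ gTypedQ ends l h 𝓤 𝓓 𝓓'' X 𝓤' ∧ redEdges ends ζ' h ∈ 𝓔).card ≤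
      ((decoCubeRR ends A Z RR ζ).filter fun ζ' =>
        ζ' ∈ gTypedQ ends l h 𝓤 𝓓 𝓓'' X 𝓤' ∧ blueEdges ends ζ' h ∈ 𝓔).card := by
  have key := card_le_of_cube_edges (ends := ends) (decoRealRR ends A Z RR ζ)
    hb.decoRealRR_injective (decoCubeRR ends A Z RR ζ) (fun ζ' => mem_decoCubeRR)
    (↑(gTypedQ ends l h 𝓤 𝓓 𝓓'' X 𝓤'))
    (fun ω' ω hω hQ => hb.decoRealRR_mem_gTypedQ_of_le hh h𝓤 h𝓓 h𝓓'' h𝓤' hX hω hQ) h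
    (fun 𝓔' h𝓔' ω ω' hω hω𝓔 => h𝓔' (hb.redEdges_decoRealRR_mono hh hω) hω𝓔)
    (fun 𝓔' h𝓔' ω' ω hω hω𝓔 => h𝓔' (hb.blueEdges_decoRealRR_anti hh hω) hω𝓔)
    (fun ω => hb.blueEdges_decoRealRR_flipAll hh ω) h𝓔
  simpa only [Finset.mem_coe] using key

end Ineq

end LocRows

end Summit.Ventures.PercRepro2
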